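import Summits.CriticalPhenomena.SAWScalingLimit.Theorems.SAWLoopFugacityFlowIsingBoundaryRatioWindowRectPolygonCoords
import HarnessLib

/-!
# The offset boundary polygon: points it avoids
(line `fk-anchor-transfer`, crux `IsingBoundaryRatio`, stmt-CriticalPhenomena-10650; helper file of the stub
`windowRectPresentation_holds`)

With `0 < η`, `4η ≤ δ`, the offset boundary polygon consists of SIDE points (`z ∈ [framePt δ d' η (-η),
framePt δ d' η η]`, `d'` an external dart) and CONNECTOR points (`framePt δ a t (±η)`, `aedge a ∈ E`,
`η ≤ t ≤ δ - η`) (`range_arcPath_subset`). Here we list, in the frame `framePt δ (x, k) a b = δx + a e_k + b e_{k+1}`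
of an arrow `(x, k)`, families of points that are NOT of these two kinds (or only in a controlled way):

* `tail_*` — points `(s, 0)`, `η < s < δ - η`, of the open missing edge beyond the bud (whisker tails);
* `test_*` — points `(η + u, c)`, `|u|, |c| < η`: on a side only for the dart `(x, k)` itself and `u = 0`;
* `inside_*` — points `(s, c)`, `|s|, |c| < η` (the open square about `δx`);
* `edgeLine_*` — points `(s, 0)`, `0 ≤ s ≤ δ/2`, of an edge `aedge (x, k) ∈ E` (paths inside the domain);
* `centerLine_*` — points `(δ/2, c)`, `|c| ≤ δ/2`, across a NON-edge `aedge (x, k) ∉ E` (paths between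
  centres of exterior squares), and `approach_*` — points `(s, c)`, `η < s ≤ δ/2`, `0 < c < η`;
* `near_verts_of_*` — every side/connector point is within `δ` of a vertex of `E` in each coordinate.

All proofs: localise at `x` (`side_near`, `conn_near`), rotate into the frame `k` (`framePt_eq_frame`) and
compare coordinates (`framePt_inj_iff`). [folklore]
-/

noncomputable section

open scoped Classical
open Set Literature.Probability.LatticeModels Literature.Probability.LatticeModels.DiscreteRect

namespace Summit.CriticalPhenomena.SAWScalingLimit.Theorems.IsingBoundaryRatio

namespace WindowRect

variable {δ η : ℝ} {E : Finset (Sym2 (Site 2))}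

/-- Coordinate offsets of a frame point with small frame coordinates are small. [folklore] -/
theorem framePt_offsets_lt {x : Site 2} {k : Fin 4} {a b m : ℝ} (ha : |a| < m) (hb : |b| < m) :
    |(framePt δ (x, k) a b).re - δ * x 0| < m ∧ |(framePt δ (x, k) a b).im - δ * x 1| < m := by
  rcases framePt_offsets (δ := δ) x k a b with ⟨h0, h1⟩ | ⟨h0, h1⟩ | ⟨h0, h1⟩ | ⟨h0, h1⟩ <;> rw [h0, h1]
  · exact ⟨ha, hb⟩
  · exact ⟨by rwa [abs_neg], ha⟩
  · exact ⟨by rwa [abs_neg], by rwa [abs_neg]⟩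
  · exact ⟨hb, by rwa [abs_neg]⟩

/-- **Side points near `δx`, in the frame `k`**: a point `framePt δ (x, k) a b` with `|a|, |b| < δ - η` on
the side of a dart `(v, K)` has `v = x` and frame-`k` coordinates `(η, s)`, `(-s, η)`, `(-η, -s)` or
`(s, -η)` (`|s| ≤ η`) according as `K = k, k+1, k+2, k+3`. [folklore] -/
theorem side_frame (hδ : 0 < δ) (hη : 0 < η) {x v : Site 2} {K k : Fin 4} {a b : ℝ} (ha : |a| < δ - η)
    (hb : |b| < δ - η)
    (hz : framePt δ (x, k) a b ∈ segment ℝ (framePt δ (v, K) η (-η)) (framePt δ (v, K) η η)) :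
    v = x ∧ ∃ s, |s| ≤ η ∧ ((K = k ∧ a = η ∧ b = s) ∨ (K = k + 1 ∧ a = -s ∧ b = η) ∨
      (K = k + 2 ∧ a = -η ∧ b = -s) ∨ (K = k + 3 ∧ a = s ∧ b = -η)) := by
  obtain ⟨hre, him⟩ := framePt_offsets_lt (δ := δ) (x := x) (k := k) ha hb
  obtain ⟨rfl, s, hs, heq⟩ := side_near hδ hη hz hre him
  refine ⟨rfl, s, hs, ?_⟩
  rcases framePt_eq_frame (δ := δ) v K k η s with ⟨hK, h⟩ | ⟨hK, h⟩ | ⟨hK, h⟩ | ⟨hK, h⟩ <;>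
    rw [h, framePt_inj_iff] at heq <;> obtain ⟨h1, h2⟩ := heq
  · exact Or.inl ⟨hK, h1, h2⟩
  · exact Or.inr (Or.inl ⟨hK, h1, h2⟩)
  · exact Or.inr (Or.inr (Or.inl ⟨hK, h1, h2⟩))
  · exact Or.inr (Or.inr (Or.inr ⟨hK, h1, h2⟩))

/-- **Connector points near `δx`, in the frame `k`**: a connector point `framePt δ (x, k) a b` with
`|a|, |b| < δ - η` lies alongside an edge `aedge (x, K) ∈ E` with frame-`k` coordinates `(t, σ)`, `(-σ, t)`,
`(-t, -σ)` or `(σ, -t)` (`η ≤ t ≤ δ - η`, `|σ| = η`) according as `K = k, k+1, k+2, k+3`. [folklore] -/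
theorem conn_frame (hδ : 0 < δ) (hη : 0 < η) {x : Site 2} {k : Fin 4} {a b : ℝ} (ha : |a| < δ - η)
    (hb : |b| < δ - η) {e : Site 2 × Fin 4} (he : aedge e ∈ E) {t₀ : ℝ} (ht₀ : t₀ ∈ Icc η (δ - η))
    (hz : framePt δ (x, k) a b = framePt δ e t₀ η ∨ framePt δ (x, k) a b = framePt δ e t₀ (-η)) :
    ∃ (K : Fin 4) (t σ : ℝ), t ∈ Icc η (δ - η) ∧ |σ| = η ∧ aedge (x, K) ∈ E ∧
      ((K = k ∧ a = t ∧ b = σ) ∨ (K = k + 1 ∧ a = -σ ∧ b = t) ∨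
        (K = k + 2 ∧ a = -t ∧ b = -σ) ∨ (K = k + 3 ∧ a = σ ∧ b = -t)) := by
  obtain ⟨hre, him⟩ := framePt_offsets_lt (δ := δ) (x := x) (k := k) ha hb
  obtain ⟨K, t, ht, hK, heq⟩ := conn_near hδ hη he ht₀ hz hre him
  obtain ⟨σ, hσ, heq⟩ : ∃ σ : ℝ, |σ| = η ∧ framePt δ (x, k) a b = framePt δ (x, K) t σ := by
    rcases heq with h | h
    · exact ⟨η, abs_of_pos hη, h⟩
    · exact ⟨-η, by rw [abs_neg, abs_of_pos hη], h⟩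
  refine ⟨K, t, σ, ht, hσ, hK, ?_⟩
  rcases framePt_eq_frame (δ := δ) x K k t σ with ⟨hK, h⟩ | ⟨hK, h⟩ | ⟨hK, h⟩ | ⟨hK, h⟩ <;>
    rw [h, framePt_inj_iff] at heq <;> obtain ⟨h1, h2⟩ := heq
  · exact Or.inl ⟨hK, h1, h2⟩
  · exact Or.inr (Or.inl ⟨hK, h1, h2⟩)
  · exact Or.inr (Or.inr (Or.inl ⟨hK, h1, h2⟩))
  · exact Or.inr (Or.inr (Or.inr ⟨hK, h1, h2⟩))

/-- `|σ| = η` means `σ = η` or `σ = -η`; in particular `σ ≠ c` whenever `|c| < η`... bookkeeping. [folklore] -/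
theorem ne_of_abs_eq_of_abs_lt {σ c : ℝ} (hσ : |σ| = η) (hc : |c| < η) : σ ≠ c := by
  rintro rfl; exact hc.ne hσ

/-! ### Whisker tails -/

/-- A tail point `(s, 0)`, `η < s < δ - η`, is on no side. [folklore] -/
theorem tail_not_side (hδ : 0 < δ) (hη : 0 < η) {x v : Site 2} {K k : Fin 4} {s : ℝ} (hs : s ∈ Ioo η (δ - η))
    (hz : framePt δ (x, k) s 0 ∈ segment ℝ (framePt δ (v, K) η (-η)) (framePt δ (v, K) η η)) : False := by
  have ha : |s| < δ - η := by rw [abs_of_pos (hη.trans hs.1)]; exact hs.2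
  have hb : |(0 : ℝ)| < δ - η := by rw [abs_zero]; linarith [hs.1, hs.2]
  obtain ⟨-, s', hs', h | h | h | h⟩ := side_frame hδ hη ha hb hz <;> obtain ⟨-, h1, h2⟩ := h
  · linarith [hs.1]
  · linarith
  · linarith [hs.1]
  · linarith

/-- A tail point is no connector point. [folklore] -/
theorem tail_not_conn (hδ : 0 < δ) (hη : 0 < η) {x : Site 2} {k : Fin 4} {s : ℝ} (hs : s ∈ Ioo η (δ - η))
    {e : Site 2 × Fin 4} (he : aedge e ∈ E) {t₀ : ℝ} (ht₀ : t₀ ∈ Icc η (δ - η))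
    (hz : framePt δ (x, k) s 0 = framePt δ e t₀ η ∨ framePt δ (x, k) s 0 = framePt δ e t₀ (-η)) : False := by
  have ha : |s| < δ - η := by rw [abs_of_pos (hη.trans hs.1)]; exact hs.2
  have hb : |(0 : ℝ)| < δ - η := by rw [abs_zero]; linarith [hs.1, hs.2]
  obtain ⟨K, t, σ, ht, hσ, -, h | h | h | h⟩ := conn_frame hδ hη ha hb he ht₀ hz <;> obtain ⟨-, h1, h2⟩ := h
  · rw [← h2, abs_zero] at hσ; linarith
  · linarith [ht.1]
  · have : σ = 0 := by linarith
    rw [this, abs_zero] at hσ; linarith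
  · linarith [ht.1]

/-! ### Test points near a bud -/

/-- A test point `(η + u, c)`, `|u|, |c| < η`, lies on the side of `(v, K)` only if `(v, K) = (x, k)` and
`u = 0`. [folklore] -/
theorem test_side (hδ : 0 < δ) (hη : 0 < η) (h4 : 4 * η ≤ δ) {x v : Site 2} {K k : Fin 4} {u c : ℝ}
    (hu : |u| < η) (hc : |c| < η)
    (hz : framePt δ (x, k) (η + u) c ∈ segment ℝ (framePt δ (v, K) η (-η)) (framePt δ (v, K) η η)) :
    (v, K) = (x, k) ∧ u = 0 := by
  obtain ⟨hu1, hu2⟩ := abs_lt.1 hu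
  obtain ⟨hc1, hc2⟩ := abs_lt.1 hc
  have ha : |η + u| < δ - η := by rw [abs_lt]; constructor <;> linarith
  have hb : |c| < δ - η := by rw [abs_lt]; constructor <;> linarith
  obtain ⟨rfl, s', hs', h | h | h | h⟩ := side_frame hδ hη ha hb hz <;> obtain ⟨hK, h1, h2⟩ := h
  · exact ⟨by rw [hK], by linarith⟩
  · linarith
  · linarith
  · linarith

/-- A test point is no connector point. [folklore] -/
theorem test_not_conn (hδ : 0 < δ) (hη : 0 < η) (h4 : 4 * η ≤ δ) {x : Site 2} {k : Fin 4} {u c : ℝ}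
    (hu : |u| < η) (hc : |c| < η) {e : Site 2 × Fin 4} (he : aedge e ∈ E) {t₀ : ℝ} (ht₀ : t₀ ∈ Icc η (δ - η))
    (hz : framePt δ (x, k) (η + u) c = framePt δ e t₀ η ∨ framePt δ (x, k) (η + u) c = framePt δ e t₀ (-η)) :
    False := by
  obtain ⟨hu1, hu2⟩ := abs_lt.1 hu
  obtain ⟨hc1, hc2⟩ := abs_lt.1 hc
  have ha : |η + u| < δ - η := by rw [abs_lt]; constructor <;> linarith
  have hb : |c| < δ - η := by rw [abs_lt]; constructor <;> linarith
  obtain ⟨K, t, σ, ht, hσ, -, h | h | h | h⟩ := conn_frame hδ hη ha hb he ht₀ hz <;> obtain ⟨-, h1, h2⟩ := h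
  · exact ne_of_abs_eq_of_abs_lt hσ hc h2.symm
  · linarith [ht.1]
  · linarith [ht.1]
  · rcases (abs_eq hη.le).1 hσ with rfl | rfl <;> linarith [ht.1]

/-! ### Points inside the square about a lattice point -/

/-- A point of the open square `|a|, |b| < η` about `δx` is on no side. [folklore] -/
theorem inside_not_side (hδ : 0 < δ) (hη : 0 < η) (h4 : 4 * η ≤ δ) {x v : Site 2} {K k : Fin 4} {a b : ℝ}
    (ha : |a| < η) (hb : |b| < η)
    (hz : framePt δ (x, k) a b ∈ segment ℝ (framePt δ (v, K) η (-η)) (framePt δ (v, K) η η)) : False := by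
  obtain ⟨ha1, ha2⟩ := abs_lt.1 ha
  obtain ⟨hb1, hb2⟩ := abs_lt.1 hb
  have ha' : |a| < δ - η := by rw [abs_lt]; constructor <;> linarith
  have hb' : |b| < δ - η := by rw [abs_lt]; constructor <;> linarith
  obtain ⟨-, s', hs', h | h | h | h⟩ := side_frame hδ hη ha' hb' hz <;> obtain ⟨-, h1, h2⟩ := h <;> linarith

/-- A point of the open square about `δx` is no connector point. [folklore] -/
theorem inside_not_conn (hδ : 0 < δ) (hη : 0 < η) (h4 : 4 * η ≤ δ) {x : Site 2} {k : Fin 4} {a b : ℝ}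
    (ha : |a| < η) (hb : |b| < η) {e : Site 2 × Fin 4} (he : aedge e ∈ E) {t₀ : ℝ} (ht₀ : t₀ ∈ Icc η (δ - η))
    (hz : framePt δ (x, k) a b = framePt δ e t₀ η ∨ framePt δ (x, k) a b = framePt δ e t₀ (-η)) : False := by
  obtain ⟨ha1, ha2⟩ := abs_lt.1 ha
  obtain ⟨hb1, hb2⟩ := abs_lt.1 hb
  have ha' : |a| < δ - η := by rw [abs_lt]; constructor <;> linarith
  have hb' : |b| < δ - η := by rw [abs_lt]; constructor <;> linarith
  obtain ⟨K, t, σ, ht, hσ, -, h | h | h | h⟩ := conn_frame hδ hη ha' hb' he ht₀ hz <;> obtain ⟨-, h1, h2⟩ := h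
  · exact ne_of_abs_eq_of_abs_lt hσ hb h2.symm
  · rw [h1, abs_neg] at ha; exact ha.ne hσ
  · rw [h2, abs_neg] at hb; exact hb.ne hσ
  · exact ne_of_abs_eq_of_abs_lt hσ ha h1.symm

/-! ### Points of an edge of `E` (paths inside the domain) -/

/-- A point `(s, 0)`, `0 ≤ s ≤ δ/2`, of an edge `aedge (x, k) ∈ E` lies on the side of an EXTERNAL dart
only... never: the only candidate is the bud of `(x, k)` itself, which is not external. [folklore] -/
theorem edgeLine_not_side (hδ : 0 < δ) (hη : 0 < η) (h4 : 4 * η ≤ δ) {x v : Site 2} {K k : Fin 4} {s : ℝ}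
    (he : aedge (x, k) ∈ E) (hs : s ∈ Icc 0 (δ / 2)) (hext : IsExtDart E (v, K))
    (hz : framePt δ (x, k) s 0 ∈ segment ℝ (framePt δ (v, K) η (-η)) (framePt δ (v, K) η η)) : False := by
  have ha : |s| < δ - η := by rw [abs_of_nonneg hs.1]; linarith [hs.2]
  have hb : |(0 : ℝ)| < δ - η := by rw [abs_zero]; linarith
  obtain ⟨rfl, s', hs', h | h | h | h⟩ := side_frame hδ hη ha hb hz <;> obtain ⟨hK, h1, h2⟩ := h
  · subst hK; exact hext.2 he
  · linarith
  · linarith [hs.1]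
  · linarith

/-- A point `(s, 0)`, `0 ≤ s ≤ δ/2`, of a lattice edge at `x` is no connector point. [folklore] -/
theorem edgeLine_not_conn (hδ : 0 < δ) (hη : 0 < η) (h4 : 4 * η ≤ δ) {x : Site 2} {k : Fin 4} {s : ℝ}
    (hs : s ∈ Icc 0 (δ / 2)) {e : Site 2 × Fin 4} (he : aedge e ∈ E) {t₀ : ℝ} (ht₀ : t₀ ∈ Icc η (δ - η))
    (hz : framePt δ (x, k) s 0 = framePt δ e t₀ η ∨ framePt δ (x, k) s 0 = framePt δ e t₀ (-η)) : False := by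
  have ha : |s| < δ - η := by rw [abs_of_nonneg hs.1]; linarith [hs.2]
  have hb : |(0 : ℝ)| < δ - η := by rw [abs_zero]; linarith
  obtain ⟨K, t, σ, ht, hσ, -, h | h | h | h⟩ := conn_frame hδ hη ha hb he ht₀ hz <;> obtain ⟨-, h1, h2⟩ := h
  · rw [← h2, abs_zero] at hσ; linarith
  · linarith [ht.1]
  · have : σ = 0 := by linarith
    rw [this, abs_zero] at hσ; linarith
  · linarith [ht.1]

/-! ### Points between centres of exterior squares -/

/-- A point `(δ/2, c)`, `|c| ≤ δ/2`, across a lattice edge is on no side. [folklore] -/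
theorem centerLine_not_side (hδ : 0 < δ) (hη : 0 < η) (h4 : 4 * η ≤ δ) {x v : Site 2} {K k : Fin 4} {c : ℝ}
    (hc : |c| ≤ δ / 2)
    (hz : framePt δ (x, k) (δ / 2) c ∈ segment ℝ (framePt δ (v, K) η (-η)) (framePt δ (v, K) η η)) : False := by
  have ha : |δ / 2| < δ - η := by rw [abs_of_pos (by positivity)]; linarith
  have hb : |c| < δ - η := by linarith
  obtain ⟨hc1, hc2⟩ := abs_le.1 hc
  obtain ⟨-, s', hs', h | h | h | h⟩ := side_frame hδ hη ha hb hz <;> obtain ⟨-, h1, h2⟩ := h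
  · linarith
  · obtain ⟨h5, h6⟩ := abs_le.1 hs'; linarith
  · linarith
  · obtain ⟨h5, h6⟩ := abs_le.1 hs'; linarith

/-- A point `(δ/2, c)`, `|c| ≤ δ/2`, across a NON-edge `aedge (x, k) ∉ E` is no connector point. [folklore] -/
theorem centerLine_not_conn (hδ : 0 < δ) (hη : 0 < η) (h4 : 4 * η ≤ δ) {x : Site 2} {k : Fin 4} {c : ℝ}
    (hne : aedge (x, k) ∉ E) (hc : |c| ≤ δ / 2) {e : Site 2 × Fin 4} (he : aedge e ∈ E) {t₀ : ℝ}
    (ht₀ : t₀ ∈ Icc η (δ - η))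
    (hz : framePt δ (x, k) (δ / 2) c = framePt δ e t₀ η ∨ framePt δ (x, k) (δ / 2) c = framePt δ e t₀ (-η)) :
    False := by
  have ha : |δ / 2| < δ - η := by rw [abs_of_pos (by positivity)]; linarith
  have hb : |c| < δ - η := by linarith
  obtain ⟨K, t, σ, ht, hσ, hK, h | h | h | h⟩ := conn_frame hδ hη ha hb he ht₀ hz <;> obtain ⟨hKk, h1, h2⟩ := h
  · subst hKk; exact hne hK
  · rcases (abs_eq hη.le).1 hσ with rfl | rfl <;> linarith
  · linarith [ht.1]
  · rcases (abs_eq hη.le).1 hσ with rfl | rfl <;> linarith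

/-- An approach point `(s, c)`, `η < s ≤ δ/2`, `0 < c < η`, is on no side. [folklore] -/
theorem approach_not_side (hδ : 0 < δ) (hη : 0 < η) (h4 : 4 * η ≤ δ) {x v : Site 2} {K k : Fin 4} {s c : ℝ}
    (hs : s ∈ Ioc η (δ / 2)) (hc : c ∈ Ioo 0 η)
    (hz : framePt δ (x, k) s c ∈ segment ℝ (framePt δ (v, K) η (-η)) (framePt δ (v, K) η η)) : False := by
  have ha : |s| < δ - η := by rw [abs_of_pos (hη.trans hs.1)]; linarith [hs.2]
  have hb : |c| < δ - η := by rw [abs_of_pos hc.1]; linarith [hc.2]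
  obtain ⟨-, s', hs', h | h | h | h⟩ := side_frame hδ hη ha hb hz <;> obtain ⟨-, h1, h2⟩ := h
  · linarith [hs.1]
  · linarith [hc.2]
  · linarith [hs.1]
  · linarith [hc.1]

/-- An approach point is no connector point. [folklore] -/
theorem approach_not_conn (hδ : 0 < δ) (hη : 0 < η) (h4 : 4 * η ≤ δ) {x : Site 2} {k : Fin 4} {s c : ℝ}
    (hs : s ∈ Ioc η (δ / 2)) (hc : c ∈ Ioo 0 η) {e : Site 2 × Fin 4} (he : aedge e ∈ E) {t₀ : ℝ}
    (ht₀ : t₀ ∈ Icc η (δ - η))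
    (hz : framePt δ (x, k) s c = framePt δ e t₀ η ∨ framePt δ (x, k) s c = framePt δ e t₀ (-η)) : False := by
  have ha : |s| < δ - η := by rw [abs_of_pos (hη.trans hs.1)]; linarith [hs.2]
  have hb : |c| < δ - η := by rw [abs_of_pos hc.1]; linarith [hc.2]
  have hc' : |c| < η := by rw [abs_of_pos hc.1]; exact hc.2
  obtain ⟨K, t, σ, ht, hσ, -, h | h | h | h⟩ := conn_frame hδ hη ha hb he ht₀ hz <;> obtain ⟨-, h1, h2⟩ := h
  · exact ne_of_abs_eq_of_abs_lt hσ hc' h2.symm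
  · rcases (abs_eq hη.le).1 hσ with rfl | rfl <;> linarith [hs.1]
  · rcases (abs_eq hη.le).1 hσ with rfl | rfl <;> linarith [hc.1, hc.2]
  · rcases (abs_eq hη.le).1 hσ with rfl | rfl <;> linarith [hs.1]

/-! ### Everything happens near the vertices -/

/-- A side point of an external dart is within `η` of a vertex of `E` in each coordinate. [folklore] -/
theorem near_verts_of_side (hη : 0 < η) {v : Site 2} {K : Fin 4} (hext : IsExtDart E (v, K)) {z : ℂ}
    (hz : z ∈ segment ℝ (framePt δ (v, K) η (-η)) (framePt δ (v, K) η η)) :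
    ∃ w ∈ verts E, |z.re - δ * w 0| ≤ η ∧ |z.im - δ * w 1| ≤ η := by
  obtain ⟨s, ⟨hs0, hs1⟩, rfl⟩ := exists_of_mem_segment_snd (by linarith) hz
  refine ⟨v, hext.1, ?_⟩
  have hs : |s| ≤ η := abs_le.2 ⟨hs0, hs1⟩
  have hη' : |η| ≤ η := (abs_of_pos hη).le
  rcases framePt_offsets (δ := δ) v K η s with ⟨h0, h1⟩ | ⟨h0, h1⟩ | ⟨h0, h1⟩ | ⟨h0, h1⟩ <;> rw [h0, h1]
  · exact ⟨hη', hs⟩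
  · exact ⟨by rwa [abs_neg], hη'⟩
  · exact ⟨by rwa [abs_neg], by rwa [abs_neg]⟩
  · exact ⟨hs, by rwa [abs_neg]⟩

/-- A connector point is within `δ` of a vertex of `E` in each coordinate. [folklore] -/
theorem near_verts_of_conn (hη : 0 < η) {e : Site 2 × Fin 4} (he : aedge e ∈ E) {t : ℝ}
    (ht : t ∈ Icc η (δ - η)) {z : ℂ} (hz : z = framePt δ e t η ∨ z = framePt δ e t (-η)) :
    ∃ w ∈ verts E, |z.re - δ * w 0| ≤ δ ∧ |z.im - δ * w 1| ≤ δ := by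
  obtain ⟨v, K⟩ := e
  refine ⟨v, fst_mem_verts_of_aedge_mem he, ?_⟩
  have hδη : η ≤ δ := by linarith [ht.1, ht.2]
  obtain ⟨σ, hσ, rfl⟩ : ∃ σ : ℝ, |σ| ≤ δ ∧ z = framePt δ (v, K) t σ := by
    rcases hz with rfl | rfl
    · exact ⟨η, by rwa [abs_of_pos hη], rfl⟩
    · exact ⟨-η, by rwa [abs_neg, abs_of_pos hη], rfl⟩
  have ht' : |t| ≤ δ := by rw [abs_of_pos (hη.trans_le ht.1)]; linarith [ht.2]
  rcases framePt_offsets (δ := δ) v K t σ with ⟨h0, h1⟩ | ⟨h0, h1⟩ | ⟨h0, h1⟩ | ⟨h0, h1⟩ <;> rw [h0, h1]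
  · exact ⟨ht', hσ⟩
  · exact ⟨by rwa [abs_neg], ht'⟩
  · exact ⟨by rwa [abs_neg], by rwa [abs_neg]⟩
  · exact ⟨hσ, by rwa [abs_neg]⟩

end WindowRect

/-- **Whisker tails avoid the sides of the polygon**, closed form (registered sub-goal of
stmt-CriticalPhenomena-10650). [folklore] -/
theorem windowRect_tail_not_side : ∀ {δ η : ℝ}, 0 < δ → 0 < η → ∀ {x v : Site 2} {K k : Fin 4} {s : ℝ}, s ∈ Set.Ioo η (δ - η) → WindowRect.framePt δ (x, k) s 0 ∈ segment ℝ (WindowRect.framePt δ (v, K) η (-η)) (WindowRect.framePt δ (v, K) η η) → False :=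
  fun hδ hη _ _ _ _ _ hs hz => WindowRect.tail_not_side hδ hη hs hz

end Summit.CriticalPhenomena.SAWScalingLimit.Theorems.IsingBoundaryRatio

end
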